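import Mathlib
import HarnessLib
import Literature.MathematicalPhysics.KineticTheory.HardSphereEuler
import Literature.MathematicalPhysics.KineticTheory.BackwardCluster

/-!
# Sketch — crux-ideate `GibbsLightCone` (stmt-AtomisticToContinuum-12501), ideator 2, round 1

STANDALONE COPY for the crux directory (imports Literature only: the farm was incoherent on the
route module `…Theses.RelayRaceLocality` when this was written, 2026-08-16T08Z). The folder version
`Sketch.lean` (attached as item evidence, `lean check` rc 0) imports the route file and states
`ReductionA` with the crux decl BY NAME; here the conclusion of `ReductionA` is the verbatim body of
`RelayRaceLocality.GibbsLightCone` under the private name `cruxBody` — a skeleton line MUST use the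
route decl by name (`…Theses.RelayRaceLocality.GibbsLightCone`), never this copy.

First lemmas of the three idea cards (statements only; they elaborate over existing
declarations; nothing here is proved or filed as an item).

* Card `log-window-tagged-tail`   : `WindowComposition` (deterministic), `GibbsInvariance`,
                                    `TaggedWindowSpanTail` (= C⁺), `ReductionA`.
* Card `restarted-history-induction`: `OneWindowClusterTail` (first rung of the induction).
* Card `aimed-arrival-freshness`  : `OneWindowSurvival` (first collision LOWER bound).
-/

namespace Summit.AtomisticToContinuum.HydrodynamicLimit.Cruxes.GibbsLightCone.IdeatorTwoStandalone

open Literature.MathematicalPhysics.KineticTheory Literature.Analysis.FluidPDE MeasureTheory Filter Set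

/-- Mean-free-path scale of `N+1` spheres of reduced diameter `σ` on the unit torus:
`ℓ_N = (N+1)^{-1/3} / σ²` (the true mean free path is `ℓ_N/(√2 π)` up to the contact factor). -/
noncomputable def mfpScale (σ : ℝ) (N : ℕ) : ℝ :=
  ((N + 1 : ℕ) : ℝ) ^ (-(1 / 3 : ℝ)) / σ ^ 2

/-- Mean-free-time scale `τ_N = ℓ_N / √θ`. -/
noncomputable def mftScale (σ θ : ℝ) (N : ℕ) : ℝ :=
  mfpScale σ N / Real.sqrt θ

/-- CARD A, first lemma (deterministic, sure statement on one good orbit): backward clusters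
compose over windows (`backwardSweep_eq_sweep`), hence a UNIFORM per-window, per-particle span
bound `L` gives the span bound `n · L` for every backward cluster over `(0, nW]`. -/
def WindowComposition : Prop :=
  ∀ (N : ℕ) (ε : ℝ) (Φ : HardSphereFlow (Torus.geometry (Fin 3)) ε N) (z : Config N (Fin 3) T3),
    z ∈ Φ.good → ∀ (W L : ℝ), 0 < W → 0 ≤ L → ∀ n : ℕ,
      (∀ a : ℕ, a < n → ∀ q r : Fin N,
          (r = q ∨ r ∈ Φ.backwardCluster q (a * W) ((a + 1) * W) z) →
          Torus.euclidDist ((Φ.flow (a * W) z) r).1 ((Φ.flow ((a + 1) * W) z) q).1 ≤ L) →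
      ∀ i j : Fin N, (j = i ∨ j ∈ Φ.backwardCluster i 0 (n * W) z) →
        Torus.euclidDist (z j).1 ((Φ.flow (n * W) z) i).1 ≤ n * L

/-- Invariance of the homogeneous Gibbs law under every hard-sphere flow (provable now:
Liouville is preserved, the canonical density is a function of the kinetic energy and of the
hard-sphere domain indicator). -/
def GibbsInvariance : Prop :=
  ∀ (σ a θ : ℝ), 0 < σ → σ < 1 / 2 → 0 < a → 0 < θ → ∀ (N : ℕ)
    (Φ : HardSphereFlow (Torus.geometry (Fin 3)) (hsDiameter σ N) (N + 1)) (s : ℝ),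
    (localGibbsLaw σ (fun _ => a) (fun _ => 0) (fun _ => θ) N Φ).map (Φ.flow s) =
      localGibbsLaw σ (fun _ => a) (fun _ => 0) (fun _ => θ) N Φ

/-- CARD A, the transferred statement C⁺ (`TaggedWindowSpanTail`): ONE tagged particle, a window
of `M` mean-free-time units, exponential-in-`M` tail for the span of its backward cluster,
uniformly in `N` (eventually) and in `σ < σ₀`; only `M ≍ log N` is consumed by the reduction. -/
def TaggedWindowSpanTail : Prop :=
  ∀ a θ : ℝ, 0 < a → 0 < θ → ∃ σ₀ : ℝ, 0 < σ₀ ∧ ∃ lam c C : ℝ, 0 < c ∧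
    ∀ σ : ℝ, 0 < σ → σ < σ₀ →
    ∀ Φ : (N : ℕ) → HardSphereFlow (Torus.geometry (Fin 3)) (hsDiameter σ N) (N + 1),
    ∀ᶠ N in atTop, ∀ p : Fin (N + 1), ∀ M : ℝ, 1 ≤ M →
      localGibbsLaw σ (fun _ => a) (fun _ => 0) (fun _ => θ) N (Φ N)
        {z | ∃ r : Fin (N + 1), (r = p ∨ r ∈ (Φ N).backwardCluster p 0 (M * mftScale σ θ N) z) ∧
              lam * M * mfpScale σ N <
                Torus.euclidDist (z r).1 (((Φ N).flow (M * mftScale σ θ N) z) p).1}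
        ≤ ENNReal.ofReal (C * Real.exp (-c * M))

/-- Verbatim body of the crux decl `RelayRaceLocality.GibbsLightCone` (stmt-AtomisticToContinuum-12501),
copied ONLY so that this standalone file elaborates without the route module; not a restatement for use. -/
private def cruxBody : Prop :=
  ∀ a θ : ℝ, 0 < a → 0 < θ → ∃ σ₀ : ℝ, 0 < σ₀ ∧ ∃ c : ℝ, 0 < c ∧ ∀ σ : ℝ, 0 < σ → σ < σ₀ →
    ∀ Φ : (N : ℕ) → HardSphereFlow (Torus.geometry (Fin 3)) (hsDiameter σ N) (N + 1), ∀ t : ℝ, 0 ≤ t →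
    ∀ δ : ℝ, 0 < δ → Tendsto (fun N => localGibbsLaw σ (fun _ => a) (fun _ => 0) (fun _ => θ) N (Φ N)
      {z | ∃ i j : Fin (N + 1), (j = i ∨ j ∈ (Φ N).backwardCluster i 0 t z) ∧
        c * t + δ < Torus.euclidDist (z j).1 ((Φ N).flow t z i).1}) atTop (nhds 0)

/-- CARD A, the reduction (log-window union bound); in the folder version the conclusion is the route
decl `…Theses.RelayRaceLocality.GibbsLightCone` by name. -/
def ReductionA : Prop :=
  WindowComposition → GibbsInvariance → TaggedWindowSpanTail → cruxBody

/-- CARD B, first rung of the induction (unconditional, one Lanford window `c₀ τ_N`): geometric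
tail of the backward-cluster CARDINALITY of a tagged particle under the invariant Gibbs law,
`N`-uniform at fixed small packing (CIP 1994 Thm 4.4.1 step 3 at finite `N`). -/
def OneWindowClusterTail : Prop :=
  ∀ a θ : ℝ, 0 < a → 0 < θ → ∃ σ₀ : ℝ, 0 < σ₀ ∧ ∃ c₀ C ρ : ℝ, 0 < c₀ ∧ 0 ≤ ρ ∧ ρ < 1 ∧
    ∀ σ : ℝ, 0 < σ → σ < σ₀ →
    ∀ Φ : (N : ℕ) → HardSphereFlow (Torus.geometry (Fin 3)) (hsDiameter σ N) (N + 1),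
    ∀ᶠ N in atTop, ∀ p : Fin (N + 1), ∀ k : ℕ,
      localGibbsLaw σ (fun _ => a) (fun _ => 0) (fun _ => θ) N (Φ N)
        {z | k ≤ ((Φ N).backwardCluster p 0 (c₀ * mftScale σ θ N) z).card}
        ≤ ENNReal.ofReal (C * ρ ^ k)

/-- CARD C, first brick (a LOWER bound on collisions, the one input no a priori UPPER bound
supplies): within one mean-free-time unit a tagged particle collides with probability at least
`p₀ > 0`, uniformly in `N` (eventually) and `σ < σ₀`; `backwardCluster p 0 τ z = ∅` iff `p` has
no collision in `(0, τ]`. -/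
def OneWindowSurvival : Prop :=
  ∀ a θ : ℝ, 0 < a → 0 < θ → ∃ σ₀ : ℝ, 0 < σ₀ ∧ ∃ p₀ : ℝ, 0 < p₀ ∧
    ∀ σ : ℝ, 0 < σ → σ < σ₀ →
    ∀ Φ : (N : ℕ) → HardSphereFlow (Torus.geometry (Fin 3)) (hsDiameter σ N) (N + 1),
    ∀ᶠ N in atTop, ∀ p : Fin (N + 1),
      localGibbsLaw σ (fun _ => a) (fun _ => 0) (fun _ => θ) N (Φ N)
        {z | (Φ N).backwardCluster p 0 (mftScale σ θ N) z = ∅} ≤ ENNReal.ofReal (1 - p₀)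

/-- CARD C, the composed statement the freshness mechanism is for: conditional-free survival over
`Λ` mean-free-time units decays exponentially (flight-duration tail of a tagged particle). -/
def SurvivalDamping : Prop :=
  ∀ a θ : ℝ, 0 < a → 0 < θ → ∃ σ₀ : ℝ, 0 < σ₀ ∧ ∃ c C : ℝ, 0 < c ∧
    ∀ σ : ℝ, 0 < σ → σ < σ₀ →
    ∀ Φ : (N : ℕ) → HardSphereFlow (Torus.geometry (Fin 3)) (hsDiameter σ N) (N + 1),
    ∀ᶠ N in atTop, ∀ p : Fin (N + 1), ∀ Λ : ℝ, 1 ≤ Λ →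
      localGibbsLaw σ (fun _ => a) (fun _ => 0) (fun _ => θ) N (Φ N)
        {z | (Φ N).backwardCluster p 0 (Λ * mftScale σ θ N) z = ∅}
        ≤ ENNReal.ofReal (C * Real.exp (-c * Λ))

end Summit.AtomisticToContinuum.HydrodynamicLimit.Cruxes.GibbsLightCone.IdeatorTwoStandalone
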